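import Summits.QuantumAdvantage.QuantumAdvantage.Theorems.SymplecticPurityDeqThesisKillCompose

/-!
# Crux `DeqThesis` (stmt-QuantumAdvantage-0242), line `Sketch` — stub `stub_killComposeGen`

The KILL side of the line, made generic in the circuit family: family-level local flatness of ANY
uniform oracle-free Clifford+T family `F` (at rate `2^{-δ|x|}` on inputs of unbounded length, against
every locally rotated non-identity Pauli string) refutes the LU-dressed free-frame road ("every
uniform oracle-free Clifford+T family has at every input/stage a layer of single-qubit unitaries `⊗u`
and a Clifford `U` making EVERY linear cut of `U (⊗u) ψ` have purity `≥ 1/(|x|^c + c)`").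

Proof: the proof of `stub_killCompose` verbatim, with the road specialised to `F` itself instead of
`cubeFamily`; the cut `k = ⌊δ'|x|⌋ ≤ |x| ≤ |x| + F.ancillas |x|` fits on the register for any ancilla
count. The LU reduction `lff_luReduction` turns flatness against rotated strings into Pauli flatness
of the unit vector `(⊗u)ψ`; the route's purity bound in every Clifford frame
(`norm_puritySum_mulVec_le`) at the cut `k` bounds the purity by `2^{-k} + 2^k ε² < 3·2^{-δ'|x|}`,
while exponential decay beats `1/(|x|^c + c)` (`lff_eventually_three_mul_lt_pow`).
-/

noncomputable section

set_option linter.dupNamespace false -- D-0017: single-problem summit ⇒ `QuantumAdvantage.QuantumAdvantage` by design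

namespace Summit.QuantumAdvantage.QuantumAdvantage.Theorems.SymplecticPurity

open Matrix Finset
open Literature.Computability.QuantumComplexity Literature.Computability.Cryptography
open Literature.Barriers.QuantumAdvantage

/-- **Stub · `stub_killComposeGen`**: family-level local flatness of any uniform oracle-free
Clifford+T family `F` (rate `2^{-δ|x|}`, inputs of unbounded length, every locally rotated
non-identity Pauli string) refutes the LU-dressed free-frame road. -/
theorem stub_killComposeGen :
    ∀ F : QCircuitFamily cliffordT, F.IsOracleFree → F.IsUniform →
    (∃ δ : ℝ, 0 < δ ∧ ∀ n₀ : ℕ, ∃ x : List Bool, n₀ ≤ x.length ∧ ∃ j : ℕ,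
      ∀ u : Fin (x.length + F.ancillas x.length) → Matrix Bool Bool ℂ,
        (∀ i, u i ∈ Matrix.unitaryGroup Bool ℂ) →
        ∀ S : Fin (x.length + F.ancillas x.length) → Pauli, S ≠ (fun _ => Pauli.I) →
          ‖star (F.stateAfter x j) ⬝ᵥ
              (tensorAll (fun i => u i * (S i).mat * star (u i))).mulVec (F.stateAfter x j)‖
            ≤ (2 : ℝ) ^ (-(δ * (x.length : ℝ)))) →
    ¬ (∀ F : QCircuitFamily cliffordT, F.IsOracleFree → F.IsUniform → ∃ c : ℕ, ∀ x : List Bool, ∀ j : ℕ,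
      ∃ u : Fin (x.length + F.ancillas x.length) → Matrix Bool Bool ℂ,
        (∀ i, u i ∈ Matrix.unitaryGroup Bool ℂ) ∧
        ∃ U : Matrix (QReg (x.length + F.ancillas x.length)) (QReg (x.length + F.ancillas x.length)) ℂ,
          U ∈ Matrix.unitaryGroup (QReg (x.length + F.ancillas x.length)) ℂ ∧
          (∀ S : Fin (x.length + F.ancillas x.length) → Pauli,
            ∃ S' : Fin (x.length + F.ancillas x.length) → Pauli, ∃ c' : ℂ, ‖c'‖ = 1 ∧
              U * pauliString S * star U = c' • pauliString S') ∧
          ∀ k ≤ x.length + F.ancillas x.length,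
            (1 : ℝ) / (x.length ^ c + c) ≤
              ‖puritySum k (U.mulVec ((tensorAll u).mulVec (F.stateAfter x j)))‖) := by
  intro F hOF hU hflat hroad
  obtain ⟨δ, hδ, H⟩ := hflat
  obtain ⟨c, hc⟩ := hroad F hOF hU
  -- shrink the rate to `δ' ≤ 1` so that the cut `⌊δ'|x|⌋` fits on the register
  obtain ⟨δ', hδ'pos, hδ'le, hδ'le1⟩ : ∃ δ' : ℝ, 0 < δ' ∧ δ' ≤ δ ∧ δ' ≤ 1 :=
    ⟨min δ 1, lt_min hδ one_pos, min_le_left _ _, min_le_right _ _⟩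
  -- exponential decay at base `2^δ' > 1` beats the road's polynomial beyond `n₀`
  have hr : (1 : ℝ) < (2 : ℝ) ^ δ' := Real.one_lt_rpow one_lt_two hδ'pos
  obtain ⟨n₀, hn₀⟩ := lff_eventually_three_mul_lt_pow c hr
  -- a flat input of length `≥ n₀`, a flat stage, and the road's dressed frame there
  obtain ⟨x, hx, j, hflatx⟩ := H n₀
  obtain ⟨u, hu, U, hU, hcl, hpur⟩ := hc x j
  -- the dressed state `(⊗u) ψ` is a unit vector ...
  set ψ := F.stateAfter x j with hψdef
  have hψ : normSq ψ = 1 := normSq_stateAfter_cliffordT F x j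
  have hT : tensorAll u ∈ Matrix.unitaryGroup (QReg (x.length + F.ancillas x.length)) ℂ :=
    lff_tensorAll_mem_unitaryGroup u hu
  have hψ' : normSq ((tensorAll u).mulVec ψ) = 1 := by
    rw [normSq_mulVec_of_mem_unitaryGroup hT]; exact hψ
  -- ... and `2^{-δ'|x|}`-Pauli-flat, by the LU reduction applied with the layer `star ∘ u`
  have hmono : (2 : ℝ) ^ (-(δ * (x.length : ℝ))) ≤ (2 : ℝ) ^ (-(δ' * (x.length : ℝ))) :=
    Real.rpow_le_rpow_of_exponent_le one_le_two
      (neg_le_neg (mul_le_mul_of_nonneg_right hδ'le (Nat.cast_nonneg _)))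
  have hflat' : ∀ S : Fin (x.length + F.ancillas x.length) → Pauli,
      S ≠ (fun _ => Pauli.I) →
        ‖pauliExp S ((tensorAll u).mulVec ψ)‖ ≤ (2 : ℝ) ^ (-(δ' * (x.length : ℝ))) := by
    intro S hS
    rw [pauliExp, lff_luReduction]
    exact (hflatx (fun i => star (u i)) (fun i => Unitary.star_mem (hu i)) S hS).trans hmono
  -- the cut `k = ⌊δ'|x|⌋ ≤ |x| ≤ |x| + ancillas`
  set k : ℕ := ⌊δ' * (x.length : ℝ)⌋₊ with hkdef
  have hδn : 0 ≤ δ' * (x.length : ℝ) := mul_nonneg hδ'pos.le (Nat.cast_nonneg _)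
  have hkle : (k : ℝ) ≤ δ' * (x.length : ℝ) := Nat.floor_le hδn
  have hklt : δ' * (x.length : ℝ) < k + 1 := Nat.lt_floor_add_one _
  have hk : k ≤ x.length + F.ancillas x.length := by
    have h1 : (k : ℝ) ≤ x.length := hkle.trans
      ((mul_le_mul_of_nonneg_right hδ'le1 (Nat.cast_nonneg _)).trans (one_mul _).le)
    have h2 : k ≤ x.length := by exact_mod_cast h1
    exact h2.trans (Nat.le_add_right _ _)
  -- the route's purity bound in the Clifford frame `U` against the road's lower bound at the cut `k`
  have hbound := norm_puritySum_mulVec_le hψ' hflat' hU hcl hk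
  rw [inv_pow] at hbound
  have hroadk := hpur k hk
  -- the arithmetic: `2^{-k} + 2^k ε² < 3 ε < 1 / (|x|^c + c)` with `ε = 2^{-δ'|x|}`
  have hEpos : (0 : ℝ) < (2 : ℝ) ^ (δ' * (x.length : ℝ)) := Real.rpow_pos_of_pos two_pos _
  have hEr : (2 : ℝ) ^ (δ' * (x.length : ℝ)) = ((2 : ℝ) ^ δ') ^ x.length := by
    rw [← Real.rpow_natCast, ← Real.rpow_mul (by norm_num : (0 : ℝ) ≤ 2)]
  have hεE : (2 : ℝ) ^ (-(δ' * (x.length : ℝ))) = ((2 : ℝ) ^ (δ' * (x.length : ℝ)))⁻¹ :=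
    Real.rpow_neg (by norm_num : (0 : ℝ) ≤ 2) _
  have hPpos : (0 : ℝ) < (2 : ℝ) ^ k := pow_pos two_pos k
  have hPE : (2 : ℝ) ^ k ≤ (2 : ℝ) ^ (δ' * (x.length : ℝ)) := by
    rw [← Real.rpow_natCast]
    exact Real.rpow_le_rpow_of_exponent_le one_le_two hkle
  have hE2P : (2 : ℝ) ^ (δ' * (x.length : ℝ)) < 2 * (2 : ℝ) ^ k := by
    have := Real.rpow_lt_rpow_of_exponent_lt one_lt_two hklt
    rw [Real.rpow_add_one two_ne_zero, Real.rpow_natCast] at this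
    linarith
  have hD : (0 : ℝ) < (x.length : ℝ) ^ c + c := by
    rcases Nat.eq_zero_or_pos c with h0 | h0
    · subst h0; simp
    · exact add_pos_of_nonneg_of_pos (pow_nonneg (Nat.cast_nonneg _) _) (Nat.cast_pos.2 h0)
  have h3D : 3 * ((x.length : ℝ) ^ c + c) < (2 : ℝ) ^ (δ' * (x.length : ℝ)) := by
    rw [hEr]; exact hn₀ x.length hx
  generalize (2 : ℝ) ^ (δ' * (x.length : ℝ)) = E at hEpos hεE hPE hE2P h3D
  generalize (2 : ℝ) ^ (-(δ' * (x.length : ℝ))) = ε at hbound hεE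
  generalize (x.length : ℝ) ^ c + (c : ℝ) = D at hD h3D hroadk
  generalize (2 : ℝ) ^ k = P at hbound hPpos hPE hE2P
  subst hεE
  have i1 : P⁻¹ < 2 * E⁻¹ := by
    rw [← one_div, ← div_eq_mul_inv, div_lt_div_iff₀ hPpos hEpos]; linarith
  have i2 : P * E⁻¹ ^ 2 ≤ E⁻¹ :=
    calc P * E⁻¹ ^ 2 ≤ E * E⁻¹ ^ 2 := mul_le_mul_of_nonneg_right hPE (sq_nonneg _)
      _ = E⁻¹ := by rw [pow_two, ← mul_assoc, mul_inv_cancel₀ hEpos.ne', one_mul]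
  have hup : ‖puritySum k (U.mulVec ((tensorAll u).mulVec ψ))‖ < 3 * E⁻¹ := by linarith
  have hlow : 3 * E⁻¹ < 1 / D := by
    rw [lt_div_iff₀ hD]
    calc 3 * E⁻¹ * D = (3 * D) * E⁻¹ := by ring
      _ < E * E⁻¹ := mul_lt_mul_of_pos_right h3D (inv_pos.2 hEpos)
      _ = 1 := mul_inv_cancel₀ hEpos.ne'
  exact absurd (hroadk.trans_lt (hup.trans hlow)) (lt_irrefl _)

end Summit.QuantumAdvantage.QuantumAdvantage.Theorems.SymplecticPurity

end
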